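/-
Copyright (c) 2026. All rights reserved.
Released under Apache 2.0 license as described in the file LICENSE.
Authors: abc-iut cell, seat abc-iut-f-069 (gen 4; row «DPSC-NODAL-MODEL», complementary half to abc-iut-L4-t6 g7).
-/
import Literature.AnabelianGeometry.AbsoluteAnabelian.AbsTopII.DehnTwistFreeGroupInputs
import Literature.AnabelianGeometry.AbsoluteAnabelian.AbsTopII.DehnTwistLoopInertia
import Literature.AnabelianGeometry.AbsoluteAnabelian.AbsTopII.DehnTwistSemidirectLemmas
import HarnessLib

/-!
# [AbsTopII] Prop 1.3 (vi)/(vii)/(ix) at the NODAL model: decomposition groups in `Π_I = F̂₂ ⋊_{shear^i} Ẑ`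

S. Mochizuki, *Topics in Absolute Anabelian Geometry II* [AbsTopII] (bib `MochizukiAbsTopII2013`; locators =
PDF pages of the kurims manuscript `paper:url-585b8d0ad0d9`), §1, Def 1.2 (ii) p. 10 (`D_v := N_{Π_H}(Π_v)`,
`D_e := N_{Π_H}(Π_e)`, `I_e := Z_{Π_I}(Π_e)`), Prop 1.3 (vii) p. 12 ("`D_e = C_{Π_H}(Π_e) = N_{Π_H}(Π_e)` is
commensurably terminal in `Π_H`; if `e` is a node, then `I_e = D_e ∩ Π_I`"), (ix) p. 12 ("the image of `D_e` in `H`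
is open, but `D_e` is not open in `Π_H`"), (vi) p. 12 ("the image of `D_v` in `H` is open").

PROOF-ONLY companion (no definition, no instance), abc-iut-f-069 (gen 4), row «DPSC-NODAL-MODEL» of abc-iut-L4-t6 g7
— the half complementary to their S3 (`I_v`, `I_e`, branch pair, (ii′)).  Everything here is stated INSIDE THE
EXTENSION `Π_I = DehnTwist.Ext i = F̂₂ ⋊_{shear^i} Ẑ` of S1 (`DehnTwistExtension.lean`, p453388) for the closed
subgroups `S × 1 := S.map inl` with `S` the node group `Π_e = nodeGp = b^Ẑ` (abc-iut-L2's `bAxis`), the cusp group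
`Π_c = cuspGp = ⟨[a,b]⟩^` (`= cAxis`, `cuspGp_eq_cAxis`) and the vertex group `Π_v = vertGp = ⟨b^Ẑ ⊔ ab^Ẑa⁻¹⟩^` of S2
(`DehnTwistLoopDatum.lean`, p455624); abc-iut-L4-t6's S3a lemmas (`DehnTwistLoopInertia.lean`, p457431:
`shearPow_mem_nodeGp/vertGp`, `normal_range_inl`) are consumed BY NAME.  The transfer to the `DPSCIndexData`
vocabulary of `dpsc i hi` (`rfl` on `nodeSub`/`cuspSub`/`PiG`/`PiI`) is the next file.

§0 (file `DehnTwistSemidirectLemmas.lean`) GENERIC: in any `N ⋊_φ G`, for `φ`-stable `S ≤ N`, "`S ⋊ G`" is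
`S.map inl ⊔ inr.range = {x | x.left ∈ S}`, membership in `N / C / Z (S × 1)` is read on the left factor, and `S ⋊ G`
is commensurably terminal in `N ⋊ G` as soon as `S` is in `N` (abc-iut-L2-t5's C7d argument made generic).
§1 AT THE DEHN-TWIST EXTENSION (inputs: `DehnTwistFreeGroupInputs` p458558 — `Z = N = C` of `b^Ẑ` is `b^Ẑ`, `c^Ẑ`
commensurably terminal; the twist fixes `Π_v ⊇ Π_e, Π_c` pointwise):
* `normalizer_map_inl_nodeGp_eq` / `commensurator_…` / `centralizer_…`: **`D_e = C(Π_e) = N(Π_e) = I_e =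
  b^Ẑ ⋊ Ẑ`** for the node, and `isCommensurablyTerminal_…`: **`D_e` is commensurably terminal in `Π_H`** — Prop 1.3
  (vii), node half, with ZERO hypotheses; the same for the cusp (`…_cuspGp_…`, `D_c = c^Ẑ ⋊ Ẑ`) — (vii), cusp half;
* `map_mk'_eq_top_of_range_inr_le` + `not_isOpen_…`: **the image of `D_e` in `H = Π_H/Π_𝔾` is everything (open)
  and `D_e` is NOT open in `Π_H`** (a power of the stable letter `(a,1)` would lie on the axis, contradicting the
  `a`-degree `ê`) — Prop 1.3 (ix), both halves, node and cusp, ZERO hypotheses;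
* `range_inr_le_normalizer_map_inl_of_fixed`: `1 ⋊ Ẑ ≤ D_v` for every twist-fixed `Π_v`, so the image of `D_v` in
  `H` is everything — Prop 1.3 (vi), first half (the second half is vacuous at a one-vertex datum).
HONEST FRAMING: classical group theory in a constructed model (constructed ≠ geometric); the vertex clauses that
need «`N_{F̂₂}(Π_v) = Π_v`» / «`Π_v` commensurably terminal» ([CombGC] Prop 1.2 (ii) at the loop datum) are NOT
here; nothing bears on [IUTchIII] Cor 3.12; no side taken.
-/

noncomputable section

open scoped Pointwise

namespace Literature.AnabelianGeometry.AbsoluteAnabelian.AbsTopII.DehnTwist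

open Literature.AnabelianGeometry.EtaleTheta.SettingModel
open Literature.AnabelianGeometry.AbsoluteAnabelian
open Function _root_.Topology

/-! ### §1 The node and cusp decomposition groups of the Dehn-twist extension -/

variable (i : ℕ)

/-- The S2 cusp representative IS abc-iut-L2's commutator axis: `cuspGp = ⟨a b a⁻¹ b⁻¹⟩^ = c^Ẑ`.
[cite: MochizukiCombGC2007, Def 1.1(ii) p.7] -/
theorem cuspGp_eq_cAxis : cuspGp = cAxis := closure_zpowers_commutator_eq_cAxis

/-- The twist stabilises the node group `Π_e = b^Ẑ` (indeed fixes it pointwise, abc-iut-L4-t6's `shearPow_mem_nodeGp`).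
[cite: MochizukiAbsTopII2013, Prop 1.3 (ii) p.11] -/
theorem shearPow_mem_nodeGp_of_mem (k : ZH) (s : F₂hatT) (hs : s ∈ nodeGp) : shearPow i k s ∈ nodeGp := by
  rw [shearPow_mem_nodeGp i k s hs]; exact hs

/-- The twist stabilises the vertex group `Π_v` (fixes it pointwise, `shearPow_mem_vertGp`).
[cite: MochizukiAbsTopII2013, Prop 1.3 (iii) p.11] -/
theorem shearPow_mem_vertGp_of_mem (k : ZH) (s : F₂hatT) (hs : s ∈ vertGp) : shearPow i k s ∈ vertGp := by
  rw [shearPow_mem_vertGp i k s hs]; exact hs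

/-- The twist fixes the cusp group `Π_c = c^Ẑ ≤ Π_v` pointwise. [cite: MochizukiAbsTopII2013, Prop 1.3 (iii) p.11] -/
theorem shearPow_mem_cuspGp (k : ZH) : ∀ s ∈ cuspGp, shearPow i k s = s :=
  fun s hs => shearPow_mem_vertGp i k s (cuspGp_le_vertGp hs)

/-- The twist stabilises the cusp group. [cite: MochizukiAbsTopII2013, Prop 1.3 (iii) p.11] -/
theorem shearPow_mem_cuspGp_of_mem (k : ZH) (s : F₂hatT) (hs : s ∈ cuspGp) : shearPow i k s ∈ cuspGp := by
  rw [shearPow_mem_cuspGp i k s hs]; exact hs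

/-- `C_{F̂₂}(Π_e) = Π_e` on the S2 name. [cite: MochizukiCombGC2007, Prop 1.2 p.8] -/
theorem commensurator_nodeGp_eq : Subgroup.Commensurable.commensurator nodeGp = nodeGp := commensurator_bAxis_eq

/-- `Π_e` is commensurably terminal in `F̂₂`, on the S2 name. [cite: MochizukiCombGC2007, Prop 1.2 p.8] -/
theorem isCommensurablyTerminal_nodeGp : IsCommensurablyTerminal nodeGp := isCommensurablyTerminal_bAxis

/-- `Π_c` is commensurably terminal in `F̂₂`. [cite: MochizukiCombGC2007, Prop 1.2 p.8] -/
theorem isCommensurablyTerminal_cuspGp : IsCommensurablyTerminal cuspGp := by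
  rw [cuspGp_eq_cAxis]; exact isCommensurablyTerminal_cAxis

/-- `C_{F̂₂}(Π_c) = Π_c`. [cite: MochizukiCombGC2007, Prop 1.2 p.8] -/
theorem commensurator_cuspGp_eq : Subgroup.Commensurable.commensurator cuspGp = cuspGp :=
  isCommensurablyTerminal_cuspGp.commensurator_eq

/-- **Prop 1.3 (vii), node half, equalities: `N(Π_e × 1) = b^Ẑ ⋊ Ẑ`** in `Π_H = F̂₂ ⋊_{shear^i} Ẑ`.
[cite: MochizukiAbsTopII2013, Prop 1.3 (vii) p.12] -/
theorem normalizer_map_inl_nodeGp_eq :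
    Subgroup.normalizer ((nodeGp.map (SemidirectProduct.inl : F₂hatT →* Ext i) : Subgroup (Ext i)) : Set (Ext i)) =
      nodeGp.map (SemidirectProduct.inl : F₂hatT →* Ext i) ⊔ (SemidirectProduct.inr : ZH →* Ext i).range :=
  normalizer_map_inl_eq_of_normalizer_eq (shearPow_mem_nodeGp_of_mem i) normalizer_bAxis_eq

/-- **`C(Π_e × 1) = b^Ẑ ⋊ Ẑ`** (commensurator). [cite: MochizukiAbsTopII2013, Prop 1.3 (vii) p.12] -/
theorem commensurator_map_inl_nodeGp_eq :
    Subgroup.Commensurable.commensurator (nodeGp.map (SemidirectProduct.inl : F₂hatT →* Ext i)) =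
      nodeGp.map (SemidirectProduct.inl : F₂hatT →* Ext i) ⊔ (SemidirectProduct.inr : ZH →* Ext i).range :=
  commensurator_map_inl_eq_of_commensurator_eq (shearPow_mem_nodeGp_of_mem i) commensurator_nodeGp_eq

/-- **`Z(Π_e × 1) = b^Ẑ ⋊ Ẑ`** (so `I_e = D_e = D_e ∩ Π_I`, `Π_I = Π_H`). [cite: MochizukiAbsTopII2013, Prop 1.3 (vii) p.12] -/
theorem centralizer_map_inl_nodeGp_eq :
    Subgroup.centralizer ((nodeGp.map (SemidirectProduct.inl : F₂hatT →* Ext i) : Subgroup (Ext i)) : Set (Ext i)) =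
      nodeGp.map (SemidirectProduct.inl : F₂hatT →* Ext i) ⊔ (SemidirectProduct.inr : ZH →* Ext i).range :=
  centralizer_map_inl_eq_of_centralizer_eq (shearPow_mem_nodeGp i) centralizer_bAxis_eq

/-- **Prop 1.3 (vii), node half: `D_e = N(Π_e × 1)` is commensurably terminal in `Π_H`** — ZERO hypotheses at
the nodal model. [cite: MochizukiAbsTopII2013, Prop 1.3 (vii) p.12] -/
theorem isCommensurablyTerminal_normalizer_map_inl_nodeGp :
    IsCommensurablyTerminal (Subgroup.normalizer
      ((nodeGp.map (SemidirectProduct.inl : F₂hatT →* Ext i) : Subgroup (Ext i)) : Set (Ext i))) := by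
  rw [normalizer_map_inl_nodeGp_eq]
  exact isCommensurablyTerminal_map_inl_sup_range_inr (shearPow_mem_nodeGp_of_mem i) isCommensurablyTerminal_nodeGp

/-- **Prop 1.3 (vii), cusp half, equalities: `N(Π_c × 1) = c^Ẑ ⋊ Ẑ`**. [cite: MochizukiAbsTopII2013, Prop 1.3 (vii) p.12] -/
theorem normalizer_map_inl_cuspGp_eq :
    Subgroup.normalizer ((cuspGp.map (SemidirectProduct.inl : F₂hatT →* Ext i) : Subgroup (Ext i)) : Set (Ext i)) =
      cuspGp.map (SemidirectProduct.inl : F₂hatT →* Ext i) ⊔ (SemidirectProduct.inr : ZH →* Ext i).range :=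
  normalizer_map_inl_eq_of_normalizer_eq (shearPow_mem_cuspGp_of_mem i)
    (isCommensurablyTerminal_cuspGp.isNormallyTerminal.normalizer_eq)

/-- **`C(Π_c × 1) = c^Ẑ ⋊ Ẑ`** (commensurator). [cite: MochizukiAbsTopII2013, Prop 1.3 (vii) p.12] -/
theorem commensurator_map_inl_cuspGp_eq :
    Subgroup.Commensurable.commensurator (cuspGp.map (SemidirectProduct.inl : F₂hatT →* Ext i)) =
      cuspGp.map (SemidirectProduct.inl : F₂hatT →* Ext i) ⊔ (SemidirectProduct.inr : ZH →* Ext i).range :=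
  commensurator_map_inl_eq_of_commensurator_eq (shearPow_mem_cuspGp_of_mem i) commensurator_cuspGp_eq

/-- **Prop 1.3 (vii), cusp half: `D_c = N(Π_c × 1)` is commensurably terminal in `Π_H`** — ZERO hypotheses.
[cite: MochizukiAbsTopII2013, Prop 1.3 (vii) p.12] -/
theorem isCommensurablyTerminal_normalizer_map_inl_cuspGp :
    IsCommensurablyTerminal (Subgroup.normalizer
      ((cuspGp.map (SemidirectProduct.inl : F₂hatT →* Ext i) : Subgroup (Ext i)) : Set (Ext i))) := by
  rw [normalizer_map_inl_cuspGp_eq]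
  exact isCommensurablyTerminal_map_inl_sup_range_inr (shearPow_mem_cuspGp_of_mem i) isCommensurablyTerminal_cuspGp

/-! ### Prop 1.3 (ix)/(vi): images in `H` and non-openness -/

/-- No positive power of the stable letter lies on an axis of `a`-degree zero: if `ê ≡ 1` on `S` then `a^m ∈ S`
forces `m = 0`. [cite: MochizukiAbsTopII2013, Prop 1.3 (ix) p.12] -/
theorem pow_eta_zero_mem_imp {S : Subgroup F₂hatT} (hS : ∀ x ∈ S, eHat x = 1) {m : ℕ}
    (hm : eta (FreeGroup.of 0) ^ m ∈ S) : m = 0 := by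
  have h := hS _ hm
  rw [map_pow, eHat_eta, expA_of_zero, ← map_pow] at h
  have h2 := iotaZ_injective (h.trans (map_one iotaZ).symm)
  rw [← ofAdd_nsmul, nsmul_eq_mul, mul_one, ← ofAdd_zero] at h2
  have h3 : (m : ℤ) = 0 := Multiplicative.ofAdd.injective h2
  exact_mod_cast h3

/-- **A subgroup `D ≤ Π_H` read on the left factor by an axis of `a`-degree zero is NOT open** (an open subgroup
of the compact `Π_H` has finite index, so would contain a positive power of `(a, 1)`).
[cite: MochizukiAbsTopII2013, Prop 1.3 (ix) p.12] -/
theorem not_isOpen_of_left_mem {S : Subgroup F₂hatT} (hS : ∀ x ∈ S, eHat x = 1) (D : Subgroup (Ext i))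
    (hD : ∀ x, x ∈ D ↔ x.left ∈ S) : ¬ IsOpen (D : Set (Ext i)) := by
  intro hopen
  haveI : Finite (Ext i ⧸ D) := Subgroup.quotient_finite_of_isOpen D hopen
  haveI : D.FiniteIndex := Subgroup.finiteIndex_of_finite_quotient
  obtain ⟨m, hm0, -, hm⟩ := D.exists_pow_mem_of_index_ne_zero Subgroup.FiniteIndex.index_ne_zero
    (SemidirectProduct.inl (eta (FreeGroup.of 0)))
  rw [← map_pow, hD, SemidirectProduct.left_inl] at hm
  exact (Nat.pos_iff_ne_zero.mp hm0) (pow_eta_zero_mem_imp hS hm)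

/-- `ê ≡ 1` on `Π_c = c^Ẑ`. [cite: MochizukiEtTh2009, §1 p.12] -/
theorem eHat_eq_one_of_mem_cuspGp {x : F₂hatT} (hx : x ∈ cuspGp) : eHat x = 1 := by
  rw [cuspGp_eq_cAxis] at hx
  obtain ⟨t, rfl⟩ := hx
  exact eHat_cPow t

/-- **Prop 1.3 (ix), node: `D_e` is NOT open in `Π_H`.** [cite: MochizukiAbsTopII2013, Prop 1.3 (ix) p.12] -/
theorem not_isOpen_normalizer_map_inl_nodeGp :
    ¬ IsOpen ((Subgroup.normalizer ((nodeGp.map (SemidirectProduct.inl : F₂hatT →* Ext i) : Subgroup (Ext i)) :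
      Set (Ext i))) : Set (Ext i)) := by
  rw [normalizer_map_inl_nodeGp_eq]
  exact not_isOpen_of_left_mem i (fun x hx => eHat_eq_one_of_mem_bAxis hx) _
    (mem_map_inl_sup_range_inr_iff (shearPow_mem_nodeGp_of_mem i))

/-- **Prop 1.3 (ix), cusp: `D_c` is NOT open in `Π_H`.** [cite: MochizukiAbsTopII2013, Prop 1.3 (ix) p.12] -/
theorem not_isOpen_normalizer_map_inl_cuspGp :
    ¬ IsOpen ((Subgroup.normalizer ((cuspGp.map (SemidirectProduct.inl : F₂hatT →* Ext i) : Subgroup (Ext i)) :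
      Set (Ext i))) : Set (Ext i)) := by
  rw [normalizer_map_inl_cuspGp_eq]
  exact not_isOpen_of_left_mem i (fun x hx => eHat_eq_one_of_mem_cuspGp hx) _
    (mem_map_inl_sup_range_inr_iff (shearPow_mem_cuspGp_of_mem i))

/-- **Prop 1.3 (ix)/(vi), image halves: the image in `H = Π_H/Π_𝔾` of the normalizer of ANY twist-stable
`S × 1` is all of `H`** (it contains the section `1 ⋊ Ẑ`), in particular open — applies to `D_e` (node), `D_c`
(cusp) and `D_v` (vertex). [cite: MochizukiAbsTopII2013, Prop 1.3 (ix) p.12] -/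
theorem map_mk'_normalizer_map_inl_eq_top {S : Subgroup F₂hatT}
    (hS : ∀ (k : ZH) (s : F₂hatT), s ∈ S → shearPow i k s ∈ S) :
    haveI := normal_range_inl i
    (Subgroup.normalizer ((S.map (SemidirectProduct.inl : F₂hatT →* Ext i) : Subgroup (Ext i)) :
        Set (Ext i))).map (QuotientGroup.mk' (SemidirectProduct.inl : F₂hatT →* Ext i).range) = ⊤ :=
  haveI := normal_range_inl i
  map_mk'_eq_top_of_range_inr_le (range_inr_le_normalizer_map_inl hS)

/-- The vertex instance of the previous statement: the image of `D_v = N(Π_v × 1)` in `H` is everything, for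
`Π_v = ⟨b^Ẑ ⊔ a·b^Ẑ·a⁻¹⟩^` (Prop 1.3 (vi), first half, at the nodal model — ZERO hypotheses).
[cite: MochizukiAbsTopII2013, Prop 1.3 (vi) p.12] -/
theorem map_mk'_normalizer_vertGp_eq_top :
    haveI := normal_range_inl i
    (Subgroup.normalizer ((vertGp.map (SemidirectProduct.inl : F₂hatT →* Ext i) : Subgroup (Ext i)) :
        Set (Ext i))).map (QuotientGroup.mk' (SemidirectProduct.inl : F₂hatT →* Ext i).range) = ⊤ :=
  map_mk'_normalizer_map_inl_eq_top i (shearPow_mem_vertGp_of_mem i)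

/-- `1 ⋊ Ẑ ≤ D_v = N(Π_v × 1)`: the twist section normalises (indeed centralises) the vertex group.
[cite: MochizukiAbsTopII2013, Prop 1.3 (vi) p.12] -/
theorem range_inr_le_normalizer_map_inl_vertGp :
    (SemidirectProduct.inr : ZH →* Ext i).range ≤
      Subgroup.normalizer ((vertGp.map (SemidirectProduct.inl : F₂hatT →* Ext i) : Subgroup (Ext i)) :
        Set (Ext i)) :=
  range_inr_le_normalizer_map_inl (shearPow_mem_vertGp_of_mem i)

/-- **`x ∈ D_v = N(Π_v × 1) ⇔ x.left ∈ N_{F̂₂}(Π_v)`** — the vertex decomposition group of the nodal model read on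
the left factor (so `D_v = N_{F̂₂}(Π_v) ⋊ Ẑ`; the clause "`D_v ∩ Π_I = I_v × Π_v`" of Prop 1.3 (iii) holds here iff
`N_{F̂₂}(Π_v) = Π_v`). [cite: MochizukiAbsTopII2013, Prop 1.3 (iii) p.11] -/
theorem mem_normalizer_map_inl_vertGp_iff (x : Ext i) :
    x ∈ Subgroup.normalizer ((vertGp.map (SemidirectProduct.inl : F₂hatT →* Ext i) : Subgroup (Ext i)) :
        Set (Ext i)) ↔
      x.left ∈ Subgroup.normalizer (vertGp : Set F₂hatT) :=
  mem_normalizer_map_inl_iff (shearPow_mem_vertGp_of_mem i) x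

end Literature.AnabelianGeometry.AbsoluteAnabelian.AbsTopII.DehnTwist

end
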